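import Mathlib
import Literature.Computability.AlgebraicComplexity.HessianAtOrigin
import Summits.ValiantsHypothesis.ValiantsHypothesis.Theorems.GrenetZeonTwoDimCoefficientsScalingClosureShadowSmooth

/-!
# Crux `GrenetZeon.TwoDimCoefficients` (stmt-ValiantsHypothesis-8062), stub `stub_dualUnipotent`:
# scaling-closure — the TORUS (second) degeneration: only weight-zero companions obstruct

After the scaling degeneration the Hessian route of the stub is reduced to the SHADOW
`Φ = c + β⁻¹·per_n + (companions)` with a rank bound at its smooth zeros (✓ `rank_hess0_shadow_le…`).  The
permanent is fixed by the torus `x_{ij} ↦ a_i b_j x_{ij}`, `Πa_iΠb_j = 1`; degenerating along a one-parameter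
subgroup `z_s ↦ d^{w_s}·z_s` (integer weights `w`) under which `c + β⁻¹·per_n` has weight `0` and every other
piece of `Φ` has POSITIVE weight kills those pieces, and the smooth-zero Hessian bound survives the limit
(✓ `smoothZeroBound_specialFibre`).  This file is that step, for an arbitrary polynomial presented as
`Φ = Φ₀ + Σ_j ψ_j` with pointwise scaling laws (no weighted-homogeneity API is needed):

* `eval_aeval_diag`, `pderiv_aeval_diag`, `hess0_transl_aeval_diag`, `rank_hess0_transl_aeval_diag` —
  diagonal substitutions `z_s ↦ c_s·z_s`: values, partials (chain rule), Hessians (`diag·H·diag`) and ranks;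
* ★ `torusClosure` — if `Φ₀` is invariant (`Φ₀(d^w·z) = Φ₀(z)`), each `ψ_j` scales with a positive power
  (`ψ_j(d^w·z) = d^{e_j}·ψ_j(z)`, `e_j ≥ 1`), and `rank Hess Φ ≤ r` at the smooth zeros of `Φ = Φ₀ + Σ ψ_j`,
  then `rank Hess Φ₀ ≤ r` at the smooth zeros of `Φ₀`.

Consequence for the stub (memo SIXTEENTH-HAND.md): the scaling-closure method proves `n² ≤ 2m` for every
unipotent dual representation whose companions are UNSTABLE for the torus of `per_n` (all companion monomials of
positive weight for one integral weight `(u_i + v_j)` with `Σu + Σv = 0`); the residual enemy is a BALANCED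
(`k`-magic) companion.

HONEST FRAMING: a generic degeneration instrument; nothing about the permanent, the stub, the crux or
`VP ≠ VNP` is proved here.

References: D. Mumford, J. Fogarty, F. Kirwan, *Geometric Invariant Theory*, Ch. 2 §1 (one-parameter subgroups;
only the elementary limit is used); T. Mignon, N. Ressayre, Int. Math. Res. Not. 2004:79, Thm. 1.1.
-/

-- single-conjunct layout `Summits/ValiantsHypothesis/ValiantsHypothesis`: the duplicated namespace
-- component is mandated by the tree.
set_option linter.dupNamespace false
set_option autoImplicit false

noncomputable section

namespace Summit.ValiantsHypothesis.ValiantsHypothesis.Theorems.GrenetZeonTwoDimCoefficients.ScalingClosure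

open MvPolynomial Matrix
open Literature.Computability.AlgebraicComplexity

/-! ### Diagonal substitutions -/

section Diag

variable {σ : Type*} [Fintype σ] [DecidableEq σ]

omit [Fintype σ] [DecidableEq σ] in
/-- Values under a diagonal substitution `z_s ↦ c_s·z_s`. [folklore] -/
theorem eval_aeval_diag (c : σ → ℂ) (Φ : MvPolynomial σ ℂ) (z : σ → ℂ) :
    eval z (aeval (fun s => MvPolynomial.C (c s) * X s) Φ) = eval (fun s => c s * z s) Φ := by
  induction Φ using MvPolynomial.induction_on with
  | C a => simp
  | add p q hp hq => simp only [map_add, hp, hq]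
  | mul_X p s hp =>
    rw [map_mul, map_mul, hp, map_mul, MvPolynomial.aeval_X, MvPolynomial.eval_X, map_mul,
      MvPolynomial.eval_C, MvPolynomial.eval_X]

omit [Fintype σ] in
/-- Chain rule for a diagonal substitution: `∂_i (Φ ∘ diag c) = c_i·(∂_i Φ) ∘ diag c`. [folklore] -/
theorem pderiv_aeval_diag (c : σ → ℂ) (Φ : MvPolynomial σ ℂ) (i : σ) :
    pderiv i (aeval (fun s => MvPolynomial.C (c s) * X s) Φ) =
      MvPolynomial.C (c i) * aeval (fun s => MvPolynomial.C (c s) * X s) (pderiv i Φ) := by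
  induction Φ using MvPolynomial.induction_on with
  | C a => simp
  | add p q hp hq =>
    simp only [map_add, hp, hq, mul_add]
  | mul_X p s hp =>
    by_cases his : i = s
    · subst his
      simp only [map_mul, MvPolynomial.aeval_X, Derivation.leibniz, smul_eq_mul, hp, map_add,
        pderiv_X, pderiv_C, Pi.single_eq_same, mul_zero, add_zero, mul_one]
      ring
    · simp only [map_mul, MvPolynomial.aeval_X, Derivation.leibniz, smul_eq_mul, hp, map_add,
        pderiv_X, pderiv_C, Pi.single_eq_of_ne (Ne.symm his), mul_zero, add_zero, map_zero]
      ring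

/-- The Hessian at a point under a diagonal substitution: `Hess(Φ∘diag c)(z) = diag c·Hess Φ(c·z)·diag c`.
[folklore] -/
theorem hess0_transl_aeval_diag (c : σ → ℂ) (Φ : MvPolynomial σ ℂ) (z : σ → ℂ) :
    hess0 (transl z (aeval (fun s => MvPolynomial.C (c s) * X s) Φ)) =
      Matrix.diagonal c * hess0 (transl (fun s => c s * z s) Φ) * Matrix.diagonal c := by
  ext s t
  rw [Matrix.mul_diagonal, Matrix.diagonal_mul, hess0_transl, hess0_transl, pderiv_aeval_diag,
    pderiv_C_mul, pderiv_aeval_diag, map_mul, map_mul, MvPolynomial.eval_C, MvPolynomial.eval_C,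
    eval_aeval_diag]
  ring

/-- Hence the Hessian rank is unchanged by a diagonal substitution with non-zero scalars. [folklore] -/
theorem rank_hess0_transl_aeval_diag (c : σ → ℂ) (hc : ∀ s, c s ≠ 0) (Φ : MvPolynomial σ ℂ)
    (z : σ → ℂ) :
    (hess0 (transl z (aeval (fun s => MvPolynomial.C (c s) * X s) Φ))).rank =
      (hess0 (transl (fun s => c s * z s) Φ)).rank := by
  have hdet : IsUnit (Matrix.diagonal c).det := by
    rw [det_diagonal, isUnit_iff_ne_zero]
    exact Finset.prod_ne_zero_iff.mpr fun s _ => hc s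
  rw [hess0_transl_aeval_diag, Matrix.rank_mul_eq_left_of_isUnit_det _ _ hdet,
    Matrix.rank_mul_eq_right_of_isUnit_det _ _ hdet]

end Diag

/-! ### The torus degeneration -/

section Torus

variable {σ : Type*} [Fintype σ] [DecidableEq σ] {ι : Type*}

/-- ★ **Torus closure.**  Let `Φ = Φ₀ + Σ_{j ∈ J} ψ_j` where, for an integral weight `w`, `Φ₀` is invariant
under `z_s ↦ d^{w_s} z_s` and each `ψ_j` scales by `d^{e_j}` with `e_j ≥ 1` (pointwise laws, `d ≠ 0`).  If
`rank Hess Φ ≤ r` at every smooth zero of `Φ`, then `rank Hess Φ₀ ≤ r` at every smooth zero of `Φ₀`.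
(Family `P(z, s) = Φ₀(z) + Σ_j s^{e_j} ψ_j(z)`: special fibre `Φ₀`, slice `s = d` equal to `Φ ∘ diag(d^w)`;
✓ `smoothZeroBound_specialFibre`, diagonal transport.) [folklore] -/
theorem torusClosure (Φ₀ : MvPolynomial σ ℂ) (J : Finset ι) (ψ : ι → MvPolynomial σ ℂ) (e : ι → ℕ)
    (w : σ → ℤ) (r : ℕ) (he : ∀ j ∈ J, 1 ≤ e j)
    (hΦ₀ : ∀ d : ℂ, d ≠ 0 → ∀ z : σ → ℂ, eval (fun s => d ^ (w s) * z s) Φ₀ = eval z Φ₀)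
    (hψ : ∀ j ∈ J, ∀ d : ℂ, d ≠ 0 → ∀ z : σ → ℂ,
      eval (fun s => d ^ (w s) * z s) (ψ j) = d ^ (e j) * eval z (ψ j))
    (hbound : ∀ z : σ → ℂ, eval z (Φ₀ + ∑ j ∈ J, ψ j) = 0 →
      (∃ i, eval z (pderiv i (Φ₀ + ∑ j ∈ J, ψ j)) ≠ 0) →
      (hess0 (transl z (Φ₀ + ∑ j ∈ J, ψ j))).rank ≤ r)
    (z₀ : σ → ℂ) (hz : eval z₀ Φ₀ = 0) (hgrad : ∃ i, eval z₀ (pderiv i Φ₀) ≠ 0) :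
    (hess0 (transl z₀ Φ₀)).rank ≤ r := by
  classical
  -- the torus family `P(z, s) = Φ₀(z) + Σ_j s^{e_j} ψ_j(z)`
  set P : MvPolynomial (Option σ) ℂ :=
    rename some Φ₀ + ∑ j ∈ J, (X none) ^ (e j) * rename some (ψ j) with hP
  have h0 : ∀ z : σ → ℂ, eval (fun o : Option σ => o.elim (0 : ℂ) z) P = eval z Φ₀ := by
    intro z
    have hcomp : ((fun o : Option σ => o.elim (0 : ℂ) z) ∘ some) = z := funext fun _ => rfl
    rw [hP, map_add, map_sum, MvPolynomial.eval_rename, hcomp]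
    have hzero : ∑ j ∈ J, eval (fun o : Option σ => o.elim (0 : ℂ) z)
        ((X none) ^ (e j) * rename some (ψ j)) = 0 :=
      Finset.sum_eq_zero fun j hj => by
        have hej : e j ≠ 0 := by have := he j hj; omega
        rw [map_mul, map_pow, MvPolynomial.eval_X]
        simp [zero_pow hej]
    rw [hzero, add_zero]
  have hslice : ∀ d : ℂ, d ≠ 0 → ∀ z : σ → ℂ,
      eval (fun o : Option σ => o.elim d z) P =
        eval (fun s => d ^ (w s) * z s) (Φ₀ + ∑ j ∈ J, ψ j) := by
    intro d hd z
    have hcomp : ((fun o : Option σ => o.elim d z) ∘ some) = z := funext fun _ => rfl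
    rw [hP, map_add, map_sum, MvPolynomial.eval_rename, hcomp, map_add, map_sum, hΦ₀ d hd z]
    congr 1
    refine Finset.sum_congr rfl fun j hj => ?_
    rw [map_mul, map_pow, MvPolynomial.eval_X, MvPolynomial.eval_rename, hcomp, hψ j hj d hd z]
    rfl
  refine smoothZeroBound_specialFibre P Φ₀ r h0 ?_ z₀ hz hgrad
  rintro x hx0 hxP ⟨i, hPi⟩
  set d : ℂ := x none with hd
  set z : σ → ℂ := fun s => x (some s) with hz'
  have hx : x = fun o : Option σ => o.elim d z := by
    funext o
    cases o <;> rfl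
  set c : σ → ℂ := fun s => d ^ (w s) with hc
  have hcs : ∀ s, c s ≠ 0 := fun s => zpow_ne_zero _ hx0
  set g : Option σ → MvPolynomial σ ℂ := fun o => o.elim (MvPolynomial.C d) X with hg
  set Pd : MvPolynomial σ ℂ := aeval g P with hPd
  have hsl : ∀ z' : σ → ℂ, eval (fun o : Option σ => o.elim d z') P = eval z' Pd :=
    fun z' => (eval_aeval_slice P d z').symm
  have hPd_eq : Pd = aeval (fun s => MvPolynomial.C (c s) * X s) (Φ₀ + ∑ j ∈ J, ψ j) := by
    apply MvPolynomial.funext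
    intro z'
    rw [← hsl z', hslice d hx0 z', eval_aeval_diag]
  have hH : (Matrix.of fun s t : σ => pderiv (some s) (pderiv (some t) P)).map (eval x) =
      hess0 (transl z Pd) := by
    rw [hx]
    exact hessian_slice P Pd d hsl z
  rw [hH, hPd_eq, rank_hess0_transl_aeval_diag c hcs]
  apply hbound
  · rw [← eval_aeval_diag, ← hPd_eq, ← hsl z, ← hx, hxP]
  · refine ⟨i, ?_⟩
    have h1 : eval x (pderiv (some i) P) = eval z (pderiv i Pd) := by
      rw [hx]
      exact eval_pderiv_some_slice P Pd d hsl z i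
    rw [h1, hPd_eq, pderiv_aeval_diag, map_mul, MvPolynomial.eval_C, eval_aeval_diag] at hPi
    exact right_ne_zero_of_mul hPi

end Torus

end Summit.ValiantsHypothesis.ValiantsHypothesis.Theorems.GrenetZeonTwoDimCoefficients.ScalingClosure

end
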